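import Summits.ResolutionOfSingularities.ResolutionOfSingularities.Theorems.FrobeniusLadderFInjectiveMacaulayficationToricChartPresentationPrelim
import Summits.ResolutionOfSingularities.ResolutionOfSingularities.Theorems.WildQuotientsWildQuotientResolutionJordanThreeChartsA
import HarnessLib

/-!
# TORIC CHART CERTIFICATES — THE SINGULAR-CHART PRESENTATION THEOREM: a certified Rees chart of a toric blow-up IS (≅) ANOTHER presented cone ring
# (crux `FInjectiveMacaulayfication` stmt-ResolutionOfSingularities-15315, chain w45a, door v41.1; res-L1-w45a-plan-1 RULING R23.7 (B-L); seat res-L1-w45a-lead-1 g12;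
# generalises res-L1-w45c-stub-4's `ToricChart.isRegularRing_chartRing_of_check` — whose charts must be affine spaces — to ARBITRARY (singular) toric charts)

[OURS · L1 W4.5a] Support file (`--supports stmt-ResolutionOfSingularities-15315 --as helper`); replaces the role of NO printed item; NOT a statement of any manuscript;
def-free (the certificate enters as explicit tables + finitely many decidable identities as hypotheses; no new structure); UNCONDITIONAL; no named fact.
AI-written (AI review is weaker than expert review).

SETTING. `A = ToricChart.Ring k P D` a presented cone ring, `𝔞 = (cc_l)_l`, `cc_l = wordElem (G l)`, a monomial centre, `j₀` a generator; `D′ : ConeDatum d′ r′` a SECOND cone datum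
(the candidate presentation of the chart `(A[𝔞t])_{(cc_{j₀} t)} ≅ A[𝔞/cc_{j₀}]`). CERTIFICATE: every symbol `σ′` of `D′` is sent to a fraction
`(∏_l cc_l^{numG σ′ l} · wordElem (numW σ′)) / cc_{j₀}^{K σ′}` (`Σ_l numG = K`, so it lies in the chart ring); tables `lamP / lamM / mu` write the symbols of `A` and the fractions
`cc_l / cc_{j₀}` as WORDS of `D′` (exponent identities `hV1–hV3`); an integer matrix `ELL` carries the `x′`-exponent of each `D′`-symbol to the Laurent `x`-exponent of its fraction
(`hLp / hLm`) and has a left inverse up to `det ≠ 0` (`hBinv`). CONCLUSION: `Ring k P D′ ≃+* chartRing cc j₀`. Proof = the w45c proof with `k[x]` replaced by `Ring k P D′`: the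
substitution `φ̃ : k[Y′] → A[1/cc_{j₀}]` kills `ker (presentation D′)` because `Λ ∘ φ̃ = Ψ ∘ toLaurent ∘ presentation′` with `Λ : A[1/cc_{j₀}] ↪ k[x^{±1}]` (injective: `A` is a
domain embedded by `θ`) and `Ψ = mapDomain ELL`; it has range `A[𝔞/cc_{j₀}]` (`JordanThree.range_eq_blowupAlgebra_of_chart`) and is injective (`Ψ`, `toLaurent` injective).
First consumer: `…RMonoidLoop` — the LOOP LEMMA «a Rees chart of `Bl_{Sing_red} U_R` is `≅ U_R`». (The face-localisation `k[R]_{P_τ} ≅` cone point over `k(t)` of (B-M2) is NOT a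
corollary: it presents a localisation at a non-maximal prime, not a Rees chart.)

* ★ `nonempty_ringEquiv_chartRing` — the presentation theorem (context-free plumbing in `…ToricChartPresentationPrelim`).
[folklore; cite: CoxLittleSchenck2011, §3.3 (context: a toric blow-up = star subdivision; its affine charts are the affine toric varieties of the subdivided cones); StacksProject, Tag 052Q (affine blow-up algebra)]
-/

-- single-problem summit: the doubled namespace component is forced
set_option linter.dupNamespace false

noncomputable section

namespace Summit.ResolutionOfSingularities.ResolutionOfSingularities.Theorems.FInjectiveMacaulayfication.ToricChartPresentation

open MvPolynomial IsLocalization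
open Literature.AlgebraicGeometry.Resolution
open Summit.ResolutionOfSingularities.ResolutionOfSingularities.Theorems.WildQuotientResolution
open Summit.ResolutionOfSingularities.ResolutionOfSingularities.Theorems.WildQuotientResolution.ToricChart

variable {k : Type} [Field k] {P : Type}

/-! ## The presentation theorem -/

variable (k P)

set_option maxHeartbeats 400000 in
/-- ★ **THE SINGULAR-CHART PRESENTATION THEOREM.** Let `A = ToricChart.Ring k P D`, `cc_l = wordElem (G l)` (`l < m`) a monomial centre, `j₀` one of its generators, and
`D′ : ConeDatum d′ r′` a second cone datum. Suppose given: for every pure symbol `s′` / mixed symbol `j′` of `D′` a fraction `∏ cc_l^{numG l}·wordElem numW / cc_{j₀}^{K}`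
(`Σ numG = K`: `hKp`, `hKm`); words `lamP s`, `lamM j`, `mu l` of `D′` with the exponent identities `hV1`, `hV2`, `hV3` (symbols of `A` and fractions `cc_l/cc_{j₀}` as words in
the fractions); an integer matrix `ELL` mapping the `x′`-exponents of the `D′`-symbols to the Laurent `x`-exponents of their fractions (`hLp`, `hLm`) with `Binv · ELL = det · 1`,
`det ≠ 0`. Then the chart ring `(A[𝔞t])_{(cc_{j₀}t)}` of `Bl_𝔞 Spec A` is isomorphic to the presented cone ring `ToricChart.Ring k P D′`. [OURS; folklore toric geometry] -/
theorem nonempty_ringEquiv_chartRing [Finite P] {d r : ℕ} (D : ConeDatum d r) {m : ℕ} (G : Fin m → Word d r) (j₀ : Fin m)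
    {d' r' : ℕ} (D' : ConeDatum d' r')
    (Kp : Fin d' → ℕ) (numGp : Fin d' → Fin m → ℕ) (numWp : Fin d' → Word d r)
    (Km : Fin r' → ℕ) (numGm : Fin r' → Fin m → ℕ) (numWm : Fin r' → Word d r)
    (lamP : Fin d → Word d' r') (lamM : Fin r → Word d' r') (mu : Fin m → Word d' r')
    (ELL : Fin d → Fin d' → ℤ) (det : ℤ) (Binv : Fin d' → Fin d → ℤ)
    (hKp : ∀ s', fsum m (numGp s') = Kp s') (hKm : ∀ j', fsum m (numGm j') = Km j')
    (hV1 : ∀ (s : Fin d) (t : Fin d), wordExp D (pureWord s) t +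
        ((fsum d' fun s' => (lamP s).wp s' * Kp s') + fsum r' fun j' => (lamP s).wm j' * Km j') * wordExp D (G j₀) t =
      (fsum d' fun s' => (lamP s).wp s' * ((fsum m fun l => numGp s' l * wordExp D (G l) t) + wordExp D (numWp s') t)) +
        fsum r' fun j' => (lamP s).wm j' * ((fsum m fun l => numGm j' l * wordExp D (G l) t) + wordExp D (numWm j') t))
    (hV2 : ∀ (j : Fin r) (t : Fin d), wordExp D (mixedWord j) t +
        ((fsum d' fun s' => (lamM j).wp s' * Kp s') + fsum r' fun j' => (lamM j).wm j' * Km j') * wordExp D (G j₀) t =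
      (fsum d' fun s' => (lamM j).wp s' * ((fsum m fun l => numGp s' l * wordExp D (G l) t) + wordExp D (numWp s') t)) +
        fsum r' fun j' => (lamM j).wm j' * ((fsum m fun l => numGm j' l * wordExp D (G l) t) + wordExp D (numWm j') t))
    (hV3 : ∀ (l : Fin m) (t : Fin d), wordExp D (G l) t +
        ((fsum d' fun s' => (mu l).wp s' * Kp s') + fsum r' fun j' => (mu l).wm j' * Km j') * wordExp D (G j₀) t =
      (fsum d' fun s' => (mu l).wp s' * ((fsum m fun l' => numGp s' l' * wordExp D (G l') t) + wordExp D (numWp s') t)) +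
        (fsum r' fun j' => (mu l).wm j' * ((fsum m fun l' => numGm j' l' * wordExp D (G l') t) + wordExp D (numWm j') t)) + wordExp D (G j₀) t)
    (hLp : ∀ (s' : Fin d') (t : Fin d), ((fsum m fun l => numGp s' l * wordExp D (G l) t) + wordExp D (numWp s') t : ℤ) - Kp s' * wordExp D (G j₀) t =
      ELL t s' * D'.pw s')
    (hLm : ∀ (j' : Fin r') (t : Fin d), ((fsum m fun l => numGm j' l * wordExp D (G l) t) + wordExp D (numWm j') t : ℤ) - Km j' * wordExp D (G j₀) t =
      fsum d' fun s' => ELL t s' * D'.mx j' s')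
    (hdet : det ≠ 0) (hBinv : ∀ s' u' : Fin d', (fsum d fun t => Binv s' t * ELL t u') = if s' = u' then det else 0) :
    Nonempty (Ring k P D' ≃+* chartRing (fun l : Fin m => wordElem k P D (G l)) j₀) := by
  classical
  -- notation
  let Pr := MvPolynomial ((Fin d ⊕ P) ⊕ Fin r) k
  let A := Ring k P D
  let π : Pr →ₐ[k] A := Ideal.Quotient.mkₐ k _
  have hπ : ∀ F : Pr, π F = Ideal.Quotient.mk _ F := fun F => rfl
  let Pr' := MvPolynomial ((Fin d' ⊕ P) ⊕ Fin r') k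
  let A' := Ring k P D'
  let π' : Pr' →ₐ[k] A' := Ideal.Quotient.mkₐ k _
  let cc : Fin m → A := fun l => wordElem k P D (G l)
  change Nonempty (A' ≃+* chartRing cc j₀)
  let L := Localization.Away (cc j₀)
  let am : A →+* L := algebraMap A L
  let ι : L := Away.invSelf (cc j₀)
  have hinv : am (cc j₀) * ι = 1 := Away.mul_invSelf (S := L) (cc j₀)
  let g₀ : Fin d → ℕ := wordExp D (G j₀)
  have hθcc : ∀ l, theta (cc l) = xmon k P (wordExp D (G l)) := fun l => theta_wordElem (G l)
  haveI : IsDomain A := isDomain_ring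
  -- fractions
  have hAeq : ∀ (x y : A) (ex ey : Fin d → ℕ), theta x = xmon k P ex → theta y = xmon k P ey → ex = ey → x = y := by
    intro x y ex ey hx hy h
    apply theta_injective
    rw [hx, hy, h]
  -- the numerators of the symbol fractions and their exponents
  let nuP : Fin d' → A := fun s' => (∏ l : Fin m, cc l ^ numGp s' l) * wordElem k P D (numWp s')
  let nuM : Fin r' → A := fun j' => (∏ l : Fin m, cc l ^ numGm j' l) * wordElem k P D (numWm j')
  let neP : Fin d' → Fin d → ℕ := fun s' t => (fsum m fun l => numGp s' l * wordExp D (G l) t) + wordExp D (numWp s') t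
  let neM : Fin r' → Fin d → ℕ := fun j' t => (fsum m fun l => numGm j' l * wordExp D (G l) t) + wordExp D (numWm j') t
  have hθnuP : ∀ s', theta (nuP s') = xmon k P (neP s') := fun s' => theta_prod_pow_mul_wordElem D G (numGp s') (numWp s')
  have hθnuM : ∀ j', theta (nuM j') = xmon k P (neM j') := fun j' => theta_prod_pow_mul_wordElem D G (numGm j') (numWm j')
  -- the substitution `φ̃ : k[Y′] → L`
  let v' : (Fin d' ⊕ P) ⊕ Fin r' → L := Sum.elim (Sum.elim (fun s' => am (nuP s') * ι ^ Kp s') (fun p => am (π (X (Sum.inl (Sum.inr p)))))) (fun j' => am (nuM j') * ι ^ Km j')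
  let φt : Pr' →ₐ[k] L := aeval v'
  have hφs : ∀ s', φt (X (Sum.inl (Sum.inl s'))) = am (nuP s') * ι ^ Kp s' := fun s' => by
    show aeval v' (X _) = _; rw [MvPolynomial.aeval_X]; rfl
  have hφp : ∀ p, φt (X (Sum.inl (Sum.inr p))) = am (π (X (Sum.inl (Sum.inr p)))) := fun p => by
    show aeval v' (X _) = _; rw [MvPolynomial.aeval_X]; rfl
  have hφm : ∀ j', φt (X (Sum.inr j')) = am (nuM j') * ι ^ Km j' := fun j' => by
    show aeval v' (X _) = _; rw [MvPolynomial.aeval_X]; rfl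
  have hπC : ∀ c : k, π (MvPolynomial.C c) = algebraMap k A c := fun c => π.commutes c
  have hφC : ∀ c : k, φt (MvPolynomial.C c) = am (π (MvPolynomial.C c)) := by
    intro c
    have h1 : φt (MvPolynomial.C c) = algebraMap k L c := aeval_C v' c
    rw [h1, hπC, IsScalarTower.algebraMap_apply k A L]
  -- φ̃ of a word monomial of `D′`
  have hφword : ∀ w : Word d' r', φt (wordPoly k P w) =
      am ((∏ s', nuP s' ^ w.wp s') * ∏ j', nuM j' ^ w.wm j') * ι ^ ((fsum d' fun s' => w.wp s' * Kp s') + fsum r' fun j' => w.wm j' * Km j') := by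
    intro w
    rw [wordPoly, map_mul, map_prod, map_prod]
    simp only [map_pow, hφs, hφm]
    rw [prod_mul_pow_pow, prod_mul_pow_pow, map_mul, map_prod, map_prod, fsum_eq_sum, fsum_eq_sum]
    simp only [map_pow]
    ring
  have hθword : ∀ w : Word d' r', theta ((∏ s', nuP s' ^ w.wp s') * ∏ j', nuM j' ^ w.wm j') =
      xmon k P (fun t => (fsum d' fun s' => w.wp s' * neP s' t) + fsum r' fun j' => w.wm j' * neM j' t) :=
    theta_prod_pow_prod_pow D nuP nuM neP neM hθnuP hθnuM
  -- (1) values in the blow-up algebra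
  have hnumemP : ∀ s', nuP s' ∈ Ideal.span (Set.range cc) ^ Kp s' := by
    intro s'
    have h := prod_pow_mem_pow (Ideal.span (Set.range cc)) Finset.univ cc (fun l _ => Ideal.subset_span ⟨l, rfl⟩) (numGp s')
    rw [← fsum_eq_sum, hKp s'] at h
    exact Ideal.mul_mem_right _ _ h
  have hnumemM : ∀ j', nuM j' ∈ Ideal.span (Set.range cc) ^ Km j' := by
    intro j'
    have h := prod_pow_mem_pow (Ideal.span (Set.range cc)) Finset.univ cc (fun l _ => Ideal.subset_span ⟨l, rfl⟩) (numGm j')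
    rw [← fsum_eq_sum, hKm j'] at h
    exact Ideal.mul_mem_right _ _ h
  have hmem : ∀ p, (φt : Pr' →+* L) p ∈ blowupAlgebra (Ideal.span (Set.range cc)) (cc j₀) := by
    intro p
    induction p using MvPolynomial.induction_on with
    | C c =>
      rw [RingHom.coe_coe, hφC]
      exact Subalgebra.algebraMap_mem _ _
    | add p q hp hq =>
      rw [map_add]
      exact Subalgebra.add_mem _ hp hq
    | mul_X p i hp =>
      rw [map_mul]
      refine Subalgebra.mul_mem _ hp ?_
      rcases i with (s' | p') | j'
      · rw [RingHom.coe_coe, hφs]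
        exact algebraMap_mul_invSelf_pow_mem_blowupAlgebra (cc j₀) (Kp s') (hnumemP s')
      · rw [RingHom.coe_coe, hφp]
        exact Subalgebra.algebraMap_mem _ _
      · rw [RingHom.coe_coe, hφm]
        exact algebraMap_mul_invSelf_pow_mem_blowupAlgebra (cc j₀) (Km j') (hnumemM j')
  have hfrac0 : ∀ (x y : A) (e : ℕ), x = y * cc j₀ ^ e → am x * ι ^ e = am y := fun x y e h => algebraMap_mul_invSelf_pow_eq_zero (cc j₀) x y e h
  have hfrac1 : ∀ (x y : A) (e : ℕ), x * cc j₀ = y * cc j₀ ^ e → am x * ι ^ e = am y * ι := fun x y e h => algebraMap_mul_invSelf_pow_eq_one (cc j₀) x y e h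
  -- (2) the base ring is in the range: symbols of `A`
  have hsymb_pure : ∀ s : Fin d, am (π (X (Sum.inl (Sum.inl s)))) ∈ Set.range (φt : Pr' →+* L) := by
    intro s
    refine ⟨wordPoly k P (lamP s), ?_⟩
    rw [RingHom.coe_coe, hφword]
    have hw : π (X (Sum.inl (Sum.inl s))) = wordElem k P D (pureWord s) := by rw [hπ, wordElem, wordPoly_pureWord]
    rw [hw]
    refine hfrac0 _ _ _ (hAeq _ _ (fun t => (fsum d' fun s' => (lamP s).wp s' * neP s' t) + fsum r' fun j' => (lamP s).wm j' * neM j' t)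
      (fun t => wordExp D (pureWord s) t + ((fsum d' fun s' => (lamP s).wp s' * Kp s') + fsum r' fun j' => (lamP s).wm j' * Km j') * g₀ t) (hθword _) ?_ ?_)
    · rw [map_mul, map_pow, theta_wordElem, hθcc, ← xmon_smul, ← xmon_add]
      rfl
    · funext t; exact (hV1 s t).symm
  have hsymb_mixed : ∀ j : Fin r, am (π (X (Sum.inr j))) ∈ Set.range (φt : Pr' →+* L) := by
    intro j
    refine ⟨wordPoly k P (lamM j), ?_⟩
    rw [RingHom.coe_coe, hφword]
    have hw : π (X (Sum.inr j)) = wordElem k P D (mixedWord j) := by rw [hπ, wordElem, wordPoly_mixedWord]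
    rw [hw]
    refine hfrac0 _ _ _ (hAeq _ _ (fun t => (fsum d' fun s' => (lamM j).wp s' * neP s' t) + fsum r' fun j' => (lamM j).wm j' * neM j' t)
      (fun t => wordExp D (mixedWord j) t + ((fsum d' fun s' => (lamM j).wp s' * Kp s') + fsum r' fun j' => (lamM j).wm j' * Km j') * g₀ t) (hθword _) ?_ ?_)
    · rw [map_mul, map_pow, theta_wordElem, hθcc, ← xmon_smul, ← xmon_add]
      rfl
    · funext t; exact (hV2 j t).symm
  have hsymb : ∀ σ : (Fin d ⊕ P) ⊕ Fin r, am (π (X σ)) ∈ Set.range (φt : Pr' →+* L) := by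
    rintro ((s | p) | j)
    · exact hsymb_pure s
    · exact ⟨X (Sum.inl (Sum.inr p)), by rw [RingHom.coe_coe, hφp]⟩
    · exact hsymb_mixed j
  have hbase : ∀ x : A, am x ∈ Set.range (φt : Pr' →+* L) := by
    intro x
    obtain ⟨F, rfl⟩ := Ideal.Quotient.mk_surjective x
    change am (π F) ∈ _
    induction F using MvPolynomial.induction_on with
    | C c => exact ⟨MvPolynomial.C c, by rw [RingHom.coe_coe, hφC]⟩
    | add p q hp hq =>
      obtain ⟨p', hp'⟩ := hp
      obtain ⟨q', hq'⟩ := hq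
      exact ⟨p' + q', by rw [map_add, hp', hq', map_add, map_add]⟩
    | mul_X p σ hp =>
      obtain ⟨p', hp'⟩ := hp
      obtain ⟨s', hs'⟩ := hsymb σ
      exact ⟨p' * s', by rw [map_mul, hp', hs', map_mul, map_mul]⟩
  -- (3) the fractions `cc l / cc j₀` are in the range
  have hgen : ∀ l : Fin m, am (cc l) * ι ∈ Set.range (φt : Pr' →+* L) := by
    intro l
    refine ⟨wordPoly k P (mu l), ?_⟩
    rw [RingHom.coe_coe, hφword]
    refine hfrac1 _ _ _ (hAeq _ _ (fun t => (fsum d' fun s' => (mu l).wp s' * neP s' t) + (fsum r' fun j' => (mu l).wm j' * neM j' t) + g₀ t)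
      (fun t => wordExp D (G l) t + ((fsum d' fun s' => (mu l).wp s' * Kp s') + fsum r' fun j' => (mu l).wm j' * Km j') * g₀ t) ?_ ?_ ?_)
    · rw [map_mul, hθword, hθcc, ← xmon_add]
      rfl
    · rw [map_mul, map_pow, hθcc, hθcc, ← xmon_smul, ← xmon_add]
      rfl
    · funext t; exact (hV3 l t).symm
  -- (4) the Laurent side: `Λ : L ↪ k[x^{±1}]`, `Ψ = mapDomain ELL`, and `Λ ∘ φ̃ = Ψ ∘ toLaurent ∘ presentation′`
  let Λ₀ : A →+* Laurent k (Fin d ⊕ P) := (toLaurent k (Fin d ⊕ P)).toRingHom.comp (theta (k := k) (P := P) (D := D)).toRingHom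
  have hΛ₀ : ∀ x : A, Λ₀ x = toLaurent k (Fin d ⊕ P) (theta x) := fun x => rfl
  have hΛ₀inj : Function.Injective Λ₀ := (toLaurent_injective (k := k) (Fin d ⊕ P)).comp theta_injective
  let g₀v : (Fin d ⊕ P) →₀ ℤ := ∑ s : Fin d, g₀ s • Finsupp.single (Sum.inl s) (1 : ℤ)
  have hΛ₀cc : Λ₀ (cc j₀) = AddMonoidAlgebra.single g₀v (1 : k) := by rw [hΛ₀, hθcc, toLaurent_xmon]
  have hunit : IsUnit (Λ₀ (cc j₀)) := by rw [hΛ₀cc]; exact isUnit_single g₀v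
  let Λ : L →+* Laurent k (Fin d ⊕ P) := IsLocalization.Away.lift (cc j₀) hunit
  have hΛam : ∀ x, Λ (am x) = Λ₀ x := fun x => IsLocalization.Away.lift_eq (cc j₀) hunit x
  have hΛinj : Function.Injective Λ := lift_injective_of_injective (Submonoid.powers (cc j₀)) _ hΛ₀inj
  have hΛι : Λ ι = AddMonoidAlgebra.single (-g₀v) (1 : k) := by
    have h : Λ (am (cc j₀) * ι) = 1 := by rw [hinv, map_one]
    rw [map_mul, hΛam, hΛ₀cc] at h
    calc Λ ι = (AddMonoidAlgebra.single (-g₀v) (1 : k) * AddMonoidAlgebra.single g₀v 1) * Λ ι := by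
            rw [AddMonoidAlgebra.single_mul_single, neg_add_cancel, mul_one, ← AddMonoidAlgebra.one_def, one_mul]
      _ = AddMonoidAlgebra.single (-g₀v) (1 : k) := by rw [mul_assoc, h, mul_one]
  -- Laurent exponents of the symbol fractions
  let bzP : Fin d' → (Fin d ⊕ P) →₀ ℤ := fun s' => ∑ t : Fin d, ((neP s' t : ℤ) - Kp s' * g₀ t) • Finsupp.single (Sum.inl t) (1 : ℤ)
  let bzM : Fin r' → (Fin d ⊕ P) →₀ ℤ := fun j' => ∑ t : Fin d, ((neM j' t : ℤ) - Km j' * g₀ t) • Finsupp.single (Sum.inl t) (1 : ℤ)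
  let B' : (Fin d' ⊕ P) ⊕ Fin r' → ((Fin d ⊕ P) →₀ ℤ) := Sum.elim (Sum.elim bzP (fun p => Finsupp.single (Sum.inr p) 1)) bzM
  have hnexpv : ∀ (ne : Fin d → ℕ) (K : ℕ), (∑ t : Fin d, ne t • Finsupp.single (Sum.inl t : Fin d ⊕ P) (1 : ℤ)) =
      (∑ t : Fin d, ((ne t : ℤ) - K * g₀ t) • Finsupp.single (Sum.inl t) (1 : ℤ)) + K • g₀v := fun ne K => sum_nsmul_single_eq P ne g₀ K
  have hΛφ : ∀ w, Λ (φt (X w)) = AddMonoidAlgebra.single (B' w) (1 : k) := by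
    rintro ((s' | p) | j')
    · rw [hφs, map_mul, map_pow, hΛam, hΛ₀, hθnuP, toLaurent_xmon, hΛι, hnexpv (neP s') (Kp s'),
        AddMonoidAlgebra.single_pow, one_pow, AddMonoidAlgebra.single_mul_single, mul_one]
      change AddMonoidAlgebra.single _ _ = AddMonoidAlgebra.single (bzP s') 1
      congr 1
      rw [smul_neg, add_neg_cancel_right]
    · rw [hφp, hΛam, hΛ₀, hπ, theta_mk, presentation_X_inl_inr, toLaurent_X]
      rfl
    · rw [hφm, map_mul, map_pow, hΛam, hΛ₀, hθnuM, toLaurent_xmon, hΛι, hnexpv (neM j') (Km j'),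
        AddMonoidAlgebra.single_pow, one_pow, AddMonoidAlgebra.single_mul_single, mul_one]
      change AddMonoidAlgebra.single _ _ = AddMonoidAlgebra.single (bzM j') 1
      congr 1
      rw [smul_neg, add_neg_cancel_right]
  -- the lattice map `ℓ′` and `Ψ`
  let img : Fin d' ⊕ P → ((Fin d ⊕ P) →₀ ℤ) := Sum.elim (fun s' => ∑ t : Fin d, ELL t s' • Finsupp.single (Sum.inl t) (1 : ℤ)) (fun p => Finsupp.single (Sum.inr p) 1)
  let ℓ' : ((Fin d' ⊕ P) →₀ ℤ) →+ ((Fin d ⊕ P) →₀ ℤ) := (Finsupp.linearCombination ℤ img : ((Fin d' ⊕ P) →₀ ℤ) →ₗ[ℤ] ((Fin d ⊕ P) →₀ ℤ)).toAddMonoidHom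
  have hℓ' : ∀ f : (Fin d' ⊕ P) →₀ ℤ, ℓ' f = f.sum fun w n => n • img w := fun f => by simp [ℓ', Finsupp.linearCombination_apply]
  have hℓ'single : ∀ w (n : ℤ), ℓ' (Finsupp.single w n) = n • img w := fun w n => by
    change Finsupp.linearCombination ℤ img (Finsupp.single w n) = _
    rw [Finsupp.linearCombination_single]
  let Ψ : Laurent k (Fin d' ⊕ P) →+* Laurent k (Fin d ⊕ P) := AddMonoidAlgebra.mapDomainRingHom k ℓ'
  have hΨsingle : ∀ a (c : k), Ψ (AddMonoidAlgebra.single a c) = AddMonoidAlgebra.single (ℓ' a) c := fun a c => by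
    change AddMonoidAlgebra.mapDomain ℓ' (AddMonoidAlgebra.single a c) = _
    rw [AddMonoidAlgebra.mapDomain_single]
  -- `ℓ′` is injective (left inverse `Binv` up to `det ≠ 0`), hence so is `Ψ`
  have hℓ'inj : Function.Injective ℓ' := fun f f' h => linearCombination_img_injective (P := P) ELL det Binv hdet hBinv h
  have hΨinj : Function.Injective Ψ := AddMonoidAlgebra.mapDomain_injective hℓ'inj
  -- `Λ ∘ φ̃ = Ψ ∘ toLaurent ∘ presentation′`
  have hsymbP : ∀ s', Ψ (toLaurent k (Fin d' ⊕ P) (presentation k P D' (X (Sum.inl (Sum.inl s'))))) = AddMonoidAlgebra.single (bzP s') (1 : k) := by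
    intro s'
    rw [presentation_X_inl_inl, map_pow, toLaurent_X, AddMonoidAlgebra.single_pow, one_pow, hΨsingle, map_nsmul, hℓ'single, one_smul]
    congr 1
    change D'.pw s' • (∑ t : Fin d, ELL t s' • Finsupp.single (Sum.inl t : Fin d ⊕ P) (1 : ℤ)) = ∑ t : Fin d, ((neP s' t : ℤ) - Kp s' * g₀ t) • Finsupp.single (Sum.inl t) (1 : ℤ)
    rw [Finset.smul_sum]
    refine Finset.sum_congr rfl fun t _ => ?_
    rw [← natCast_zsmul, smul_smul]
    congr 1
    have h := hLp s' t
    simp only [neP, g₀]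
    push_cast at h ⊢
    linarith [h]
  have hsymbM : ∀ j', Ψ (toLaurent k (Fin d' ⊕ P) (presentation k P D' (X (Sum.inr j')))) = AddMonoidAlgebra.single (bzM j') (1 : k) := by
    intro j'
    rw [presentation_X_inr, toLaurent_xmon, hΨsingle, map_sum]
    congr 1
    simp only [map_nsmul, hℓ'single, one_smul]
    change (∑ s : Fin d', D'.mx j' s • ∑ t : Fin d, ELL t s • Finsupp.single (Sum.inl t : Fin d ⊕ P) (1 : ℤ)) =
      ∑ t : Fin d, ((neM j' t : ℤ) - Km j' * g₀ t) • Finsupp.single (Sum.inl t) (1 : ℤ)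
    rw [sum_nsmul_sum_zsmul_single]
    refine Finset.sum_congr rfl fun t _ => ?_
    congr 1
    have h := hLm j' t
    conv at h => rhs; rw [fsum_eq_sum]
    simp only [neM, g₀]
    push_cast at h ⊢
    linarith [h]
  have hsymbPass : ∀ p : P, Ψ (toLaurent k (Fin d' ⊕ P) (presentation k P D' (X (Sum.inl (Sum.inr p))))) = AddMonoidAlgebra.single (Finsupp.single (Sum.inr p) 1) (1 : k) := by
    intro p
    rw [presentation_X_inl_inr, toLaurent_X, hΨsingle, hℓ'single, one_smul]
    rfl
  have hcomp : Λ.comp (φt : Pr' →+* L) = Ψ.comp ((toLaurent k (Fin d' ⊕ P)).toRingHom.comp (presentation k P D').toRingHom) := by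
    refine MvPolynomial.ringHom_ext (fun c => ?_) (fun w => ?_)
    · rw [RingHom.coe_comp, Function.comp_apply, RingHom.coe_coe, hφC, hΛam, hΛ₀, hπ, theta_mk]
      change toLaurent k (Fin d ⊕ P) (presentation k P D (MvPolynomial.C c)) = Ψ (toLaurent k (Fin d' ⊕ P) (presentation k P D' (MvPolynomial.C c)))
      rw [MvPolynomial.algHom_C, MvPolynomial.algHom_C, AlgHom.commutes, AlgHom.commutes, AddMonoidAlgebra.coe_algebraMap, AddMonoidAlgebra.coe_algebraMap,
        Function.comp_apply, Function.comp_apply, hΨsingle, map_zero]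
    · rw [RingHom.coe_comp, Function.comp_apply, RingHom.coe_coe, hΛφ]
      change AddMonoidAlgebra.single (B' w) 1 = Ψ (toLaurent k (Fin d' ⊕ P) (presentation k P D' (X w)))
      rcases w with (s' | p) | j'
      · rw [hsymbP]; rfl
      · rw [hsymbPass]; rfl
      · rw [hsymbM]; rfl
  have hker : ∀ F : Pr', F ∈ RingHom.ker (presentation k P D') → φt F = 0 := by
    intro F hF
    rw [RingHom.mem_ker] at hF
    apply hΛinj
    have := congrArg (fun f : Pr' →+* Laurent k (Fin d ⊕ P) => f F) hcomp
    simp only [RingHom.coe_comp, Function.comp_apply, RingHom.coe_coe] at this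
    rw [map_zero]
    change Λ (φt F) = 0
    rw [this]
    change Ψ (toLaurent k (Fin d' ⊕ P) (presentation k P D' F)) = 0
    rw [hF, map_zero, map_zero]
  -- (5) descend to `A′ = Ring k P D′`
  let φ : A' →ₐ[k] L := Ideal.Quotient.liftₐ (RingHom.ker (presentation k P D')) φt hker
  have hφmk : ∀ F : Pr', φ (π' F) = φt F := fun F => rfl
  have hmem' : ∀ x : A', (φ : A' →+* L) x ∈ blowupAlgebra (Ideal.span (Set.range cc)) (cc j₀) := by
    intro x
    obtain ⟨F, rfl⟩ := Ideal.Quotient.mk_surjective x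
    exact hmem F
  have hbase' : ∀ x : A, am x ∈ Set.range (φ : A' →+* L) := by
    intro x
    obtain ⟨F, hF⟩ := hbase x
    exact ⟨π' F, hF⟩
  have hgen' : ∀ l : Fin m, am (cc l) * ι ∈ Set.range (φ : A' →+* L) := by
    intro l
    obtain ⟨F, hF⟩ := hgen l
    exact ⟨π' F, hF⟩
  have hrange := JordanThree.range_eq_blowupAlgebra_of_chart cc j₀ (φ : A' →+* L) hmem' hbase' hgen'
  have hinj : Function.Injective (φ : A' →+* L) := by
    rw [injective_iff_map_eq_zero]
    intro x hx
    obtain ⟨F, rfl⟩ := Ideal.Quotient.mk_surjective x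
    have h1 : φt F = 0 := hx
    have h2 : Ψ (toLaurent k (Fin d' ⊕ P) (presentation k P D' F)) = 0 := by
      have := congrArg (fun f : Pr' →+* Laurent k (Fin d ⊕ P) => f F) hcomp
      simp only [RingHom.coe_comp, Function.comp_apply, RingHom.coe_coe] at this
      change Λ (φt F) = Ψ (toLaurent k (Fin d' ⊕ P) (presentation k P D' F)) at this
      rw [← this, h1, map_zero]
    have h3 : presentation k P D' F = 0 := toLaurent_injective (k := k) (Fin d' ⊕ P) (hΨinj (by rw [h2, map_zero, map_zero]))
    exact Ideal.Quotient.eq_zero_iff_mem.mpr h3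
  -- (6) assemble the ring equivalence
  have hmemS : ∀ x, (φ : A' →+* L) x ∈ (blowupAlgebra (Ideal.span (Set.range cc)) (cc j₀)).toSubring := hmem'
  let ψ : A' →+* blowupAlgebra (Ideal.span (Set.range cc)) (cc j₀) := (φ : A' →+* L).codRestrict _ hmemS
  have hψ : Function.Bijective ψ := by
    refine ⟨fun x y h => hinj (congrArg Subtype.val h), fun z => ?_⟩
    have hz : (z : L) ∈ Set.range (φ : A' →+* L) := by
      rw [hrange]
      exact z.2
    obtain ⟨x, hx⟩ := hz
    exact ⟨x, Subtype.ext hx⟩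
  exact ⟨(RingEquiv.ofBijective ψ hψ).trans (reesChartEquiv (cc j₀) (Ideal.mem_span_range_self (f := cc) (x := j₀))).symm⟩


end Summit.ResolutionOfSingularities.ResolutionOfSingularities.Theorems.FInjectiveMacaulayfication.ToricChartPresentation

end
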